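import Summits.QuantumAdvantage.QuantumAdvantage.Theses.LinnikCubicClassGroups
import Literature.NumberTheory.CubicFields.VoronoiCylinderStep
import Literature.NumberTheory.CubicFields.PeriodicChainCells
import Literature.NumberTheory.CubicFields.PureCubicLatticeSemantics
import Literature.NumberTheory.NumberFields.PureCubicOrder

/-!
# Crux `LinnikCubicClassGroups.PureCubicClassGroupFBQP` (stmt-QuantumAdvantage-11544) — stub `stub_semMain`, part CELL (variant B)

Line `arakelov-giant-step-cycle`, stub `stub_semMain` (S5b-P5b-M): the per-position matching lemmas and the strict drift budget,
written WITHOUT importing `…StubClassTableSemCircle` (modules above it did not get hub oleans on 2026-08-16, so the composition is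
re-routed through Circle-free modules; the mathematics is that of `…StubClassTableSemMatch.lean`, p122606/p126242):

* `num_etaerr_halved` (registered `classTableSem_num_etaerr_halved`) — `2^-k (1 + (2 + 48 T 2^ℓe LB)) ≤ R/2^(s+4)`: the drift
  budget with a factor two to spare (makes the window inequality of the core strict);
* `semMatch_cellB` — the real-variable matching lemma with an elementary proof: the window `G k₀ < u < G (k₀+1)` of the target
  coordinate, its index, and the integer cell offset `⌊(t⋆ − pos)/2^(prec − npp)⌋ = ⌊(u − G k₀) 2^npp⌋`;
* `semTable_value_eq_cellB` — hence the table value `(code, offset)` is the ideal cell value (component-wise) and the chain point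
  of the cell lies strictly left of the target.
[Buchmann–Williams 1988 §3; Hallgren 2005 §4]
-/

set_option linter.dupNamespace false

namespace Summit.QuantumAdvantage.QuantumAdvantage.Theorems.LinnikCubicClassGroups

open scoped NumberField nonZeroDivisors
open NumberField
open Literature.NumberTheory.CubicFields
open Literature.NumberTheory.CubicFields.PureCubicCodes (Canon Mem)

/-- **The drift budget with a factor two to spare**: `2^-k (1 + (2 + 48 T 2^ℓe LB)) ≤ R/2^(s+4)` (`LB ≤ 2^(LD+6)`, `T = 3|ps|`). -/
theorem num_etaerr_halved {ℓe s npp LD e sz k np : ℕ} {R LB : ℝ} (hR : (1 : ℝ) / 16 ≤ R) (hsz : np < 2 ^ sz)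
    (hLB0 : 0 ≤ LB) (hLB : LB ≤ 2 ^ (LD + 6)) (hk : ℓe + s + npp + 60 + 6 * LD + e + 2 * sz ≤ k) :
    1 / 2 ^ k * (1 + (2 + 48 * (((3 * np : ℕ) : ℝ) * 2 ^ ℓe) * LB)) ≤ R / 2 ^ (s + 4) := by
  have hnp : (np : ℝ) ≤ 2 ^ sz := by exact_mod_cast hsz.le
  set M : ℕ := sz + ℓe + LD + 16 with hM
  have hsum : 1 + (2 + 48 * (((3 * np : ℕ) : ℝ) * 2 ^ ℓe) * LB) ≤ 2 ^ M := by
    have e1 : (2 : ℝ) ^ M = 2 ^ sz * 2 ^ ℓe * 2 ^ (LD + 6) * 1024 := by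
      rw [hM, show sz + ℓe + LD + 16 = sz + ℓe + (LD + 6) + 10 by omega, pow_add, pow_add, pow_add]; norm_num
    rw [e1]; push_cast
    have h1 : (1 : ℝ) ≤ 2 ^ sz * 2 ^ ℓe * 2 ^ (LD + 6) := by
      have a1 : (1:ℝ) ≤ 2 ^ sz := one_le_pow₀ (by norm_num)
      have a2 : (1:ℝ) ≤ 2 ^ ℓe := one_le_pow₀ (by norm_num)
      have a3 : (1:ℝ) ≤ 2 ^ (LD + 6) := one_le_pow₀ (by norm_num)
      calc (1:ℝ) = 1 * 1 * 1 := by ring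
        _ ≤ 2 ^ sz * 2 ^ ℓe * 2 ^ (LD + 6) := by gcongr
    have h2 : (np : ℝ) * 2 ^ ℓe * LB ≤ 2 ^ sz * 2 ^ ℓe * 2 ^ (LD + 6) := by gcongr
    nlinarith [mul_nonneg (mul_nonneg (by positivity : (0:ℝ) ≤ np) (by positivity : (0:ℝ) ≤ 2 ^ ℓe)) hLB0]
  have hexp : M + (s + 4) + 4 ≤ k := by omega
  have hpw : (2 : ℝ) ^ M * 2 ^ (s + 4) * 16 ≤ 2 ^ k := by
    rw [show (16 : ℝ) = 2 ^ 4 by norm_num, ← pow_add, ← pow_add]; exact pow_le_pow_right₀ (by norm_num) hexp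
  rw [one_div, inv_mul_eq_div, div_le_div_iff₀ (by positivity) (by positivity)]
  calc (1 + (2 + 48 * (((3 * np : ℕ) : ℝ) * 2 ^ ℓe) * LB)) * 2 ^ (s + 4) ≤ 2 ^ M * 2 ^ (s + 4) :=
        mul_le_mul_of_nonneg_right hsum (by positivity)
    _ ≤ 2 ^ k * (1 / 16) := by rw [mul_one_div, le_div_iff₀ (by norm_num)]; exact hpw
    _ ≤ 2 ^ k * R := mul_le_mul_of_nonneg_left hR (by positivity)
    _ = R * 2 ^ k := mul_comm _ _

/-- **P5b helper `classTableSem_num_etaerr_halved`** (registered): the drift budget with a factor two to spare. -/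
theorem classTableSem_num_etaerr_halved : ∀ (ℓe s npp LD e sz k np : ℕ) (R LB : ℝ), (1 : ℝ) / 16 ≤ R → np < 2 ^ sz → 0 ≤ LB → LB ≤ 2 ^ (LD + 6) → ℓe + s + npp + 60 + 6 * LD + e + 2 * sz ≤ k → 1 / 2 ^ k * (1 + (2 + 48 * (((3 * np : ℕ) : ℝ) * 2 ^ ℓe) * LB)) ≤ R / 2 ^ (s + 4) :=
  fun _ _ _ _ _ _ _ _ _ _ hR hsz hLB0 hLB hk => num_etaerr_halved hR hsz hLB0 hLB hk

/-- **Matching the stopping cell, real-variable form** (`match_cell` with an elementary proof; conclusions: the window of the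
target coordinate `u`, its index, and the integer cell offset). -/
theorem semMatch_cellB {G : ℤ → ℝ} (hG : StrictMono G) {idx : ℝ → ℤ} (hidx : ∀ x, G (idx x) ≤ x ∧ x < G (idx x + 1))
    {prec npp : ℕ} (hnpp : npp ≤ prec) {tstarc pos l : ℤ} {logα εpos η : ℝ} (hε0 : 0 ≤ εpos) (k₀ : ℤ)
    (hpos : |(pos : ℝ) - 2 ^ prec * (logα + G k₀)| ≤ εpos) (hρ : 0 ≤ tstarc - pos)
    (hlt : ((tstarc - pos : ℤ) : ℝ) < l) (hl : |(l : ℝ) - 2 ^ prec * (G (k₀ + 1) - G k₀)| ≤ 1)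
    (hη : (εpos + 2) / 2 ^ prec ≤ η)
    (hfar : ∀ (k : ℤ) (m : ℕ), (m : ℝ) / 2 ^ npp < G (k + 1) - G k →
      η < |((tstarc : ℝ) / 2 ^ prec - logα) - (G k + m / 2 ^ npp)|) :
    (G k₀ < (tstarc : ℝ) / 2 ^ prec - logα ∧ (tstarc : ℝ) / 2 ^ prec - logα < G (k₀ + 1)) ∧
      idx ((tstarc : ℝ) / 2 ^ prec - logα) = k₀ ∧
      ((tstarc - pos).toNat / 2 ^ (prec - npp) : ℕ) =
        ⌊(((tstarc : ℝ) / 2 ^ prec - logα) - G (idx ((tstarc : ℝ) / 2 ^ prec - logα))) * 2 ^ npp⌋₊ := by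
  -- abbreviations
  have hP : (0 : ℝ) < 2 ^ prec := by positivity
  have hN : (0 : ℝ) < 2 ^ npp := by positivity
  set u : ℝ := (tstarc : ℝ) / 2 ^ prec - logα with hu
  have hgap : 0 < G (k₀ + 1) - G k₀ := sub_pos.mpr (hG (lt_add_one k₀))
  have hη0 : 0 < η := lt_of_lt_of_le (div_pos (by linarith) hP) hη
  obtain ⟨hpos1, hpos2⟩ := abs_le.mp hpos
  obtain ⟨hl1, hl2⟩ := abs_le.mp hl
  have hρ' : (pos : ℝ) ≤ tstarc := by exact_mod_cast (sub_nonneg.mp hρ)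
  have hlt' : (tstarc : ℝ) - pos < l := by push_cast at hlt; exact hlt
  -- `u · 2^prec = tstarc − 2^prec logα`
  have huP : u * 2 ^ prec = tstarc - 2 ^ prec * logα := by
    rw [hu, sub_mul, div_mul_cancel₀ _ hP.ne']; ring
  -- (1) the window of `u` from the position data: `G k₀ − εpos/P ≤ u < G (k₀+1) + (εpos+1)/P`
  have hlow : (G k₀ - u) * 2 ^ prec ≤ εpos := by
    have e : (G k₀ - u) * 2 ^ prec = 2 ^ prec * (logα + G k₀) - tstarc := by rw [sub_mul, huP]; ring
    rw [e]; linarith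
  have hupp : (u - G (k₀ + 1)) * 2 ^ prec < εpos + 1 := by
    have e : (u - G (k₀ + 1)) * 2 ^ prec = tstarc - 2 ^ prec * (logα + G k₀) - 2 ^ prec * (G (k₀ + 1) - G k₀) := by
      rw [sub_mul, huP]; ring
    rw [e]; linarith
  -- (2) sharpen with `hfar` at the two chain points
  have hηP : εpos + 1 < η * 2 ^ prec := by
    have h := (div_le_iff₀ hP).mp hη
    linarith
  have hfar0 := hfar k₀ 0 (by rw [Nat.cast_zero, zero_div]; exact hgap)
  have hfar1 := hfar (k₀ + 1) 0 (by rw [Nat.cast_zero, zero_div]; exact sub_pos.mpr (hG (lt_add_one _)))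
  rw [Nat.cast_zero, zero_div, add_zero] at hfar0 hfar1
  have hk1 : G k₀ < u := by
    rcases lt_abs.mp hfar0 with h | h
    · linarith
    · -- `u ≤ G k₀ − η` contradicts `G k₀ − u ≤ εpos/P < η`
      exfalso
      have h2 : η * 2 ^ prec < (G k₀ - u) * 2 ^ prec := mul_lt_mul_of_pos_right (by linarith) hP
      linarith
  have hk2η : u < G (k₀ + 1) - η := by
    rcases lt_abs.mp hfar1 with h | h
    · exfalso
      have h2 : η * 2 ^ prec < (u - G (k₀ + 1)) * 2 ^ prec := mul_lt_mul_of_pos_right (by linarith) hP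
      linarith
    · linarith
  have hk2 : u < G (k₀ + 1) := by linarith
  have hidxu : idx u = k₀ := chain_index_eq hG hidx hk1.le hk2
  refine ⟨⟨hk1, hk2⟩, hidxu, ?_⟩
  rw [hidxu]
  -- (3) the offset
  have htn : (((tstarc - pos).toNat : ℕ) : ℝ) = (tstarc : ℝ) - pos := by
    have h : (((tstarc - pos).toNat : ℕ) : ℤ) = tstarc - pos := Int.toNat_of_nonneg hρ
    have h' := congrArg (fun z : ℤ => (z : ℝ)) h
    push_cast at h'
    exact h'
  rw [← Nat.floor_div_eq_div (K := ℝ), htn]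
  -- `(tstarc − pos)/2^(prec−npp) = x + δ`
  set x : ℝ := (u - G k₀) * 2 ^ npp with hx
  set δ : ℝ := (2 ^ prec * (logα + G k₀) - pos) * 2 ^ npp / 2 ^ prec with hδ
  have hpe : ((2 ^ (prec - npp) : ℕ) : ℝ) = 2 ^ prec / 2 ^ npp := by
    rw [eq_div_iff hN.ne']; push_cast; rw [← pow_add]; congr 1; omega
  have hxδ : ((tstarc : ℝ) - pos) / ((2 ^ (prec - npp) : ℕ) : ℝ) = x + δ := by
    rw [hpe, hx, hδ, hu]
    field_simp
    ring
  rw [hxδ]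
  have hx0 : 0 ≤ x := mul_nonneg (by linarith) hN.le
  have hδle : |δ| * 2 ^ prec ≤ εpos * 2 ^ npp := by
    rw [hδ, abs_div, abs_of_pos hP, div_mul_cancel₀ _ hP.ne', abs_mul, abs_of_pos hN]
    exact mul_le_mul_of_nonneg_right (abs_le.mpr ⟨by linarith, by linarith⟩) hN.le
  have hδη : |δ| < η * 2 ^ npp := by
    -- `|δ| ≤ εpos 2^npp / 2^prec < η 2^npp`
    have h1 : |δ| ≤ εpos * 2 ^ npp / 2 ^ prec := (le_div_iff₀ hP).mpr hδle
    have h2 : εpos * 2 ^ npp / 2 ^ prec < η * 2 ^ npp := by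
      rw [div_lt_iff₀ hP]
      have h3 : εpos < η * 2 ^ prec := by linarith
      calc εpos * 2 ^ npp < η * 2 ^ prec * 2 ^ npp := mul_lt_mul_of_pos_right h3 hN
        _ = η * 2 ^ npp * 2 ^ prec := by ring
    exact h1.trans_lt h2
  obtain ⟨hδ1, hδ2⟩ := abs_lt.mp hδη
  set m₀ : ℕ := ⌊x⌋₊ with hm₀
  have hm₀le : (m₀ : ℝ) ≤ x := Nat.floor_le hx0
  have hm₀lt : x < m₀ + 1 := Nat.lt_floor_add_one x
  have hxgap : x < (G (k₀ + 1) - G k₀ - η) * 2 ^ npp := by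
    rw [hx]; exact mul_lt_mul_of_pos_right (by linarith) hN
  -- `hfar` at `(k₀, m)` in grid units: `η 2^npp < |x − m|`
  have hfarx : ∀ m : ℕ, (m : ℝ) / 2 ^ npp < G (k₀ + 1) - G k₀ → η * 2 ^ npp < |x - m| := by
    intro m hm
    have h := hfar k₀ m hm
    have e : u - (G k₀ + m / 2 ^ npp) = (x - m) / 2 ^ npp := by
      rw [hx]; field_simp; ring
    rw [e, abs_div, abs_of_pos hN, lt_div_iff₀ hN] at h
    exact h
  -- lower bound `m₀ ≤ x + δ`
  have hlb : (m₀ : ℝ) ≤ x + δ := by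
    by_cases hm : (m₀ : ℝ) / 2 ^ npp < G (k₀ + 1) - G k₀
    · have h := hfarx m₀ hm
      rw [abs_of_nonneg (by linarith : 0 ≤ x - m₀)] at h
      linarith
    · exfalso
      have h' : G (k₀ + 1) - G k₀ ≤ (m₀ : ℝ) / 2 ^ npp := not_lt.mp hm
      rw [le_div_iff₀ hN] at h'
      have hηN : 0 < η * 2 ^ npp := mul_pos hη0 hN
      have e : (G (k₀ + 1) - G k₀ - η) * 2 ^ npp = (G (k₀ + 1) - G k₀) * 2 ^ npp - η * 2 ^ npp := by ring
      rw [e] at hxgap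
      linarith
  -- upper bound `x + δ < m₀ + 1`
  have hub : x + δ < m₀ + 1 := by
    by_cases hm : ((m₀ + 1 : ℕ) : ℝ) / 2 ^ npp < G (k₀ + 1) - G k₀
    · have h := hfarx (m₀ + 1) hm
      push_cast at h
      rw [abs_of_nonpos (by linarith : x - (m₀ + 1) ≤ 0)] at h
      linarith
    · have h' : G (k₀ + 1) - G k₀ ≤ ((m₀ + 1 : ℕ) : ℝ) / 2 ^ npp := not_lt.mp hm
      rw [le_div_iff₀ hN] at h'
      push_cast at h'
      have e : (G (k₀ + 1) - G k₀ - η) * 2 ^ npp = (G (k₀ + 1) - G k₀) * 2 ^ npp - η * 2 ^ npp := by ring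
      rw [e] at hxgap
      linarith
  rw [Nat.floor_eq_iff (le_trans (Nat.cast_nonneg _) hlb)]
  exact ⟨hlb, hub⟩


section Table

variable {K : Type} [Field K] [NumberField K] {a b : ℕ} {θ : K} {σ₁ : K →+* ℝ} {σ₂ : K →+* ℂ}
variable (hdeg : Module.finrank ℚ K = 3) (hσ₂ : ∃ z : K, starRingEnd ℂ (σ₂ z) ≠ σ₂ z)
  (ε : (𝓞 K)ˣ) (hε : 1 < σ₁ (algebraMap (𝓞 K) K ε))
  (hab : Squarefree (a * b)) (hab1 : a * b ≠ 1) (hθ : θ ^ 3 = ((a * b ^ 2 : ℕ) : K))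

include hdeg hσ₂ hε hab hab1 hθ in
/-- **The table value equals the ideal cell value** (`table_value_eq_cell`, component-wise, plus: the chain point of the cell lies strictly left of the target). -/
theorem semTable_value_eq_cellB {Ag : FractionalIdeal (𝓞 K)⁰ K} {x₀ : K} (hx₀ : x₀ ∈ posRelMinima σ₁ σ₂ Ag)
    {Lab : ℤ → ℕ × List ℤ} (hLab : ∀ i, Canon (Lab i) ∧ ∀ φ : K, Mem θ b (Lab i) φ ↔
      φ ∈ FractionalIdeal.spanSingleton (𝓞 K)⁰ (voronoiChain σ₁ σ₂ Ag x₀ i)⁻¹ * Ag)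
    {idx : ℝ → ℤ} (hidx : ∀ x, Real.log (σ₁ (voronoiChain σ₁ σ₂ Ag x₀ (idx x))) ≤ x ∧
      x < Real.log (σ₁ (voronoiChain σ₁ σ₂ Ag x₀ (idx x + 1))))
    {α : K} (hα : 0 < σ₁ α) {β : K} (hβ : β ∈ posRelMinima σ₁ σ₂ (FractionalIdeal.spanSingleton (𝓞 K)⁰ α * Ag))
    {c₁ : ℕ × List ℤ} (hc₁ : Canon c₁)
    (hm₁ : ∀ φ : K, Mem θ b c₁ φ ↔ φ ∈ FractionalIdeal.spanSingleton (𝓞 K)⁰ β⁻¹ * (FractionalIdeal.spanSingleton (𝓞 K)⁰ α * Ag))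
    {prec npp : ℕ} (hnpp : npp ≤ prec) {tstarc pos l : ℤ} {εpos η : ℝ} (hε0 : 0 ≤ εpos)
    (hpos : |(pos : ℝ) - 2 ^ prec * Real.log (σ₁ β)| ≤ εpos) (hρ : 0 ≤ tstarc - pos)
    (hlt : ((tstarc - pos : ℤ) : ℝ) < l)
    (hl : |(l : ℝ) - 2 ^ prec * (Real.log (σ₁ (voronoiSucc σ₁ σ₂ (FractionalIdeal.spanSingleton (𝓞 K)⁰ α * Ag) β)) -
      Real.log (σ₁ β))| ≤ 1)
    (hη : (εpos + 2) / 2 ^ prec ≤ η)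
    (hfar : ∀ (k : ℤ) (m : ℕ), (m : ℝ) / 2 ^ npp < Real.log (σ₁ (voronoiChain σ₁ σ₂ Ag x₀ (k + 1))) -
        Real.log (σ₁ (voronoiChain σ₁ σ₂ Ag x₀ k)) →
      η < |((tstarc : ℝ) / 2 ^ prec - Real.log (σ₁ α)) -
        (Real.log (σ₁ (voronoiChain σ₁ σ₂ Ag x₀ k)) + m / 2 ^ npp)|) :
    c₁ = Lab (idx ((tstarc : ℝ) / 2 ^ prec - Real.log (σ₁ α))) ∧
      ((tstarc - pos).toNat / 2 ^ (prec - npp) : ℕ) =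
        ⌊(((tstarc : ℝ) / 2 ^ prec - Real.log (σ₁ α)) -
          Real.log (σ₁ (voronoiChain σ₁ σ₂ Ag x₀ (idx ((tstarc : ℝ) / 2 ^ prec - Real.log (σ₁ α)))))) * 2 ^ npp⌋₊ ∧
      Real.log (σ₁ (voronoiChain σ₁ σ₂ Ag x₀ (idx ((tstarc : ℝ) / 2 ^ prec - Real.log (σ₁ α))))) <
        (tstarc : ℝ) / 2 ^ prec - Real.log (σ₁ α) := by
  have hα0 : α ≠ 0 := (map_ne_zero σ₁).mp hα.ne'
  have hmem := fun i => voronoiChain_mem hdeg hσ₂ ε hε hx₀ i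
  have hpos' : ∀ i, 0 < σ₁ (voronoiChain σ₁ σ₂ Ag x₀ i) := fun i => (hmem i).2
  set G : ℤ → ℝ := fun i => Real.log (σ₁ (voronoiChain σ₁ σ₂ Ag x₀ i)) with hG
  have hGm : StrictMono G := fun i j hij => Real.log_lt_log (hpos' i) (voronoiChain_strictMono hdeg hσ₂ ε hε hx₀ hij)
  -- `β = α θ(k₀)`
  obtain ⟨k₀, hk₀⟩ := exists_voronoiChain_eq hdeg hσ₂ ε hε hx₀ (inv_mul_mem_posRelMinima hα hβ)
  have hβeq : β = α * voronoiChain σ₁ σ₂ Ag x₀ k₀ := by rw [hk₀, ← mul_assoc, mul_inv_cancel₀ hα0, one_mul]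
  have hlogβ : Real.log (σ₁ β) = Real.log (σ₁ α) + G k₀ := by
    rw [hβeq, map_mul, Real.log_mul hα.ne' (hpos' k₀).ne']
  have hsucc : voronoiSucc σ₁ σ₂ (FractionalIdeal.spanSingleton (𝓞 K)⁰ α * Ag) β = α * voronoiChain σ₁ σ₂ Ag x₀ (k₀ + 1) := by
    rw [hβeq, voronoiSucc_mul hdeg hσ₂ ε hε hα (hmem k₀), voronoiChain_succ hdeg hσ₂ ε hε hx₀]
  have hlogsucc : Real.log (σ₁ (voronoiSucc σ₁ σ₂ (FractionalIdeal.spanSingleton (𝓞 K)⁰ α * Ag) β)) - Real.log (σ₁ β) =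
      G (k₀ + 1) - G k₀ := by
    rw [hsucc, hlogβ, map_mul, Real.log_mul hα.ne' (hpos' _).ne']; ring
  rw [hlogβ] at hpos
  rw [hlogsucc] at hl
  obtain ⟨⟨hwlo, -⟩, hidxu, hoff⟩ := semMatch_cellB hGm hidx hnpp hε0 k₀ hpos hρ hlt hl hη hfar
  refine ⟨?_, hoff, by rw [hidxu]; exact hwlo⟩
  -- the two canonical codes of `θ(k₀)⁻¹ A_g`
  rw [hidxu]
  have hind := fun c₀ c₁ c₂ h => Literature.NumberTheory.NumberFields.PureCubic.coords_eq_zero (K := K) hdeg hab hab1 hθ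
    (c₀ := c₀) (c₁ := c₁) (c₂ := c₂) h
  apply PureCubicCodes.canon_unique θ b hind _ _ hc₁ (hLab k₀).1
  intro φ
  rw [hm₁ φ, (hLab k₀).2 φ, hβeq, mul_inv, ← FractionalIdeal.spanSingleton_mul_spanSingleton]
  have e : FractionalIdeal.spanSingleton (𝓞 K)⁰ α⁻¹ * FractionalIdeal.spanSingleton (𝓞 K)⁰ (voronoiChain σ₁ σ₂ Ag x₀ k₀)⁻¹ *
      (FractionalIdeal.spanSingleton (𝓞 K)⁰ α * Ag) =
      FractionalIdeal.spanSingleton (𝓞 K)⁰ (voronoiChain σ₁ σ₂ Ag x₀ k₀)⁻¹ * Ag := by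
    rw [mul_comm (FractionalIdeal.spanSingleton (𝓞 K)⁰ α⁻¹), mul_assoc, ← mul_assoc (FractionalIdeal.spanSingleton (𝓞 K)⁰ α⁻¹),
      FractionalIdeal.spanSingleton_mul_spanSingleton, inv_mul_cancel₀ hα0, FractionalIdeal.spanSingleton_one, one_mul]
  rw [e]

end Table

end Summit.QuantumAdvantage.QuantumAdvantage.Theorems.LinnikCubicClassGroups
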